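import Summits.ResolutionOfSingularities.ResolutionOfSingularities.Theorems.HilbertSamuelEliminationSigmaMaxModificationsCorridor3WLadderStrataFibre
import Literature.AlgebraicGeometry.Resolution.BoundarySplitting
import Literature.AlgebraicGeometry.Resolution.PointBlowupHsFunMono
import HarnessLib

/-!
# [OURS · L1 W4.2] The STRATA-half of the MOVING W-ladder, eighth layer (part 1/2): CLEAN LABELS — the two ONE-STEP geometric
# kernels «clean members over the centre» (K-ctr) / «clean strict transforms» (K-str), and the label calculus of one step, PROVED

Crux chain w42 (`SigmaMaxModifications`, stmt-ResolutionOfSingularities-18506; skeleton `w_ladder` v6 on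
`SigmaMaxModificationsCorridor3`, stmt-ResolutionOfSingularities-19249), row «stub-4 → `Moving.Wlow3CharStrataM p`», seat
res-L1-w42-stub-4 (gen 4); companion of p500484 / p503069 / p503885 / p504439 / p505314 / p506465 / p508074 / p508693 /
p510273 / p511345. OURS (cell res-hironaka, slot W4.2); NOT statements of H. Hironaka's manuscript [Hironaka2017] nor of
[CossartJannsenSaito2020]; AI-drafted, weaker than expert review. Every `theorem` is PROVED; the open content is the two
`def … : Prop` rows (K-ctr) `StrataCentreMembersClean` and (K-str) `StrataStrictTransformClean`. Helper file
`--supports stmt-ResolutionOfSingularities-19249`.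

## The argument (no geometry)

Row (c-reg) `StrataCycleStartRegular` (p508074) asks: at late cycle STARTS `r` the reduced treated part `S_r = (Y_r^{(j)})_red`
is regular at the chain point. Call a label `j` CLEAN at stage `n` (`LabelCleanAt`) when the label-`j` irreducible components of
`X_n(ν)` THROUGH THE CHAIN POINT `x_n` number at most one, and that one (if present) is, at `x_n`, a regular CURVE — «regular»
read on the ambient local ring, `𝒪_{X_n,x_n}/I(Z)_{x_n}` regular (= the local ring of the reduced subscheme `Z_red` at its point over
`x_n`, tree `isRegularLocalRing_stalk_subscheme_iff`), «curve» topologically (no irreducible closed set strictly between `{x_n}`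
and `Z`). The label calculus of CJS Rem. 6.29 (1) («dominates ⇒ inherits; otherwise the new label») gives:

* (persist) a clean label `j ≤ year` stays clean at the next stage: its members through `x_{n+1}` dominate THE clean member `Z`
  through `x_n`; if `Z` lies in the canonical centre they are «members over the centre» — kernel (K-ctr); if not, they are
  dominants of a regular curve off the centre — kernel (K-str);
* (birth) the new label `year + 1` is clean: newborn components lie over the centre (p505314
  `StepProjection.subset_preimage_support_of_not_mem`), so (K-ctr) applies;
* (reset) after a CYCLE-END step (centre = the whole treated part `Y_n^{(j)}`, p503069 `support_eq_part_of_next_none`) the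
  treated label `j` is clean: its members through `x_{n+1}` dominate members inside the centre — (K-ctr) again.

Hence every label born late is clean for ever, and every OLD label is clean from the end of its first late cycle on; at a cycle
start the treated label keeps being treated until the cycle's end (`lbl_eq_treatedLabel`), so each old label offers AT MOST ONE
unclean late cycle start — finitely many exceptions in all. Finally a clean treated label gives a treated part regular at the
chain point: near `x_r` the part `Y_r^{(j)}` IS its unique member through `x_r` (the other label-`j` components are closed and miss
`x_r`), and the stalk of a vanishing ideal depends only on the germ of the closed set (tree `stalkIdeal_vanishingIdeal_congr`).

This file (part 1/2): the vocabulary `IsRegularCurveAt` / `LabelCleanAt`, the rows (K-ctr) `StrataCentreMembersClean` / (K-str)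
`StrataStrictTransformClean`, `LabelCleanAt.mem_regularLocus` (clean treated label ⇒ treated part regular over the chain point) and
the one-step lemmas `LabelCleanAt.persist`, `labelCleanAt_birth`, `labelCleanAt_reset`; part 2/2 (`…StrataCycleStart`) assembles
`strataCycleStartRegular_of_clean : (K-ctr) → (K-str) → StrataCycleStartRegular p N Q G`. The geometric content
left is ONE-STEP and LOCAL AT THE CHAIN POINT (intended proofs, `G = (ē ≤ 2)`): (K-ctr) — over a blown-up chain point the components
of `X_{n+1}(ν)` through `x_{n+1}` mapping into the centre are: none in the fibre unless the centre is the point `x_n` (Thm. 3.14,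
near-fibre rendering p514197), then the near line `ℙ(Dir_{x_n}(X_n)) ≅ ℙ^1_{k(x_n)}` (Thm. 3.14 point-centre locus p503241, `e = 2`);
over a centre CURVE `D ∋ x_n` the unique component dominating `D` (Thm. 3.6: `e_η ≤ e_{x_n} − 1 ≤ 1` at the generic point `η` of
`D`; Thm. 3.14 at `η` after localisation, Prop. 6.31; `ℙ(Dir_η) = ℙ^0`: `ProjDir_line`, PROVED p509891), which is birational onto the
regular curve `D` with `k(η)`-rational generic point, hence regular at `x_{n+1}` (a local ring strictly between a DVR and its fraction
field does not exist); (K-str) — the strict transform of a curve regular at `x_n` under a blow-up whose centre does not contain it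
is regular at its (unique) point over `x_n` (same DVR argument; the blow-down is an isomorphism off the centre).

References: CJS LNM 2270 Rem. 6.29 (1) pp. 91–92, p. 102, Thm. 3.6, Thm. 3.14, Prop. 6.31 [CossartJannsenSaito2020]; Stacks 01J7
[StacksProject]; tree `Literature…CanonicalEliminationSequence` (`Labelling`, `IsCanonicalStep`), `…BoundarySplitting`
(`stalkIdeal_vanishingIdeal_congr`), `…PointBlowupHsFunMono` (`isRegularLocalRing_stalk_subscheme_iff`), this seat's files above.
-/

noncomputable section

-- plan-1/idea-2 module setting kept (namespace `…Corridor3.Moving` re-enters `…Corridor3`)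
set_option linter.dupNamespace false

open CategoryTheory AlgebraicGeometry TopologicalSpace Topology IsLocalRing
open Summit.ResolutionOfSingularities.ResolutionOfSingularities.Theorems.CampaignW42
open Literature.AlgebraicGeometry.Resolution Literature.RingTheory.HilbertSamuel
open Literature.AlgebraicGeometry.CossartJannsenSaito2020
open Summit.ResolutionOfSingularities.ResolutionOfSingularities.Theorems.SigmaMaxModificationsCorridor3

universe u

namespace Summit.ResolutionOfSingularities.ResolutionOfSingularities.Theorems.SigmaMaxModificationsCorridor3.Moving

variable {R : ∀ S : Scheme.{u}, CentreSeq S → Prop} {N : ℕ} {ν : ℕ → ℕ}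

/-! ## §1. «A regular curve at the marked point», read on the ambient stage; clean labels -/

/-- [OURS · L1 W4.2] **`Z ⊆ X_n` is, at the marked point, a REGULAR CURVE**: `x_n ∈ Z`; the reduced closed subscheme `Z_red` is regular
at its point over `x_n` — read on the ambient local ring: `𝒪_{X_n,x_n}/I(Z)_{x_n}` is a regular local ring (tree
`isRegularLocalRing_stalk_subscheme_iff`); and `Z` is one-dimensional at `x_n` in the topological sense: every irreducible closed
subset of `Z` through `x_n` is `{x_n}` or `Z`. OURS bookkeeping vocabulary. [folklore] -/
def IsRegularCurveAt (s : MarkedStage.{u}) (Z : Set s.W) : Prop :=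
  s.pt ∈ Z ∧
    (∀ hZ : IsClosed Z, IsRegularLocalRing
      (s.W.presheaf.stalk s.pt ⧸ stalkIdeal (Scheme.IdealSheafData.vanishingIdeal ⟨Z, hZ⟩) s.pt)) ∧
    ∀ A : Set s.W, IsIrreducible A → IsClosed A → s.pt ∈ A → A ⊆ Z → A = {s.pt} ∨ A = Z

/-- [OURS · L1 W4.2] **THE LABEL `j` IS CLEAN AT THE MARKED STAGE**: the label-`j` irreducible components of `X_n(ν)` through the marked
point number at most one, and each is a regular curve at the marked point. OURS bookkeeping vocabulary. [folklore] -/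
def LabelCleanAt (N : ℕ) (ν : ℕ → ℕ) (s : MarkedStage.{u}) (j : ℕ) : Prop :=
  (∀ Z ∈ componentsThrough N ν s, ∀ Z' ∈ componentsThrough N ν s, s.L.label Z = j → s.L.label Z' = j → Z = Z') ∧
    ∀ Z ∈ componentsThrough N ν s, s.L.label Z = j → IsRegularCurveAt s Z

/-! ## §2. The two one-step geometric kernels (OPEN rows) -/

/-- [OURS · L1 W4.2] **ROW (K-ctr) — OVER A BLOWN-UP CHAIN POINT THE COMPONENTS THROUGH `x_{n+1}` MAPPING INTO THE CENTRE ARE CLEAN.**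
For every functional admissible oracle, value `ν`, `Q`-maximal origin of characteristic `p` at level `N` and every MOVING,
NEVER-ISOLATED `G`-chain from it: from some stage on, at a step `X_{n+1} → X_n` (read through its step projection `f`) whose
canonical centre `C` contains `x_n`, the irreducible components `Z'` of `X_{n+1}(ν)` through `x_{n+1}` with `f(Z') ⊆ V(C)` number
AT MOST ONE, and such a `Z'` is a regular curve at `x_{n+1}` (`IsRegularCurveAt`). Intended proof (`G = (ē ≤ 2)`): the centre's
component through `x_n` is the point `x_n` — then `Z'` lies in the near part of `π⁻¹(x_n)`, i.e. in `ℙ(Dir_{x_n}(X_n)) ≅ ℙ^{e−1}`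
(Thm. 3.14, point-centre locus), a point for `e ≤ 1` (excluded: never isolated) and the regular line `ℙ^1_{k(x_n)}` for `e = 2` —
or a regular curve `D` (Thm. 3.14 numerical shadow, p511345) — then `Z'` is not in the fibre (Thm. 3.14 near-fibre rendering,
p514197) so it dominates `D`, uniquely (`e_η ≤ 1` at the generic point `η` of `D` by Thm. 3.6, one near point over `η` by Thm. 3.14
and `ProjDir_line` after localisation, Prop. 6.31) and birationally with `k(η)`-rational generic point, whence regular at `x_{n+1}`
(no local ring lies strictly between the DVR `𝒪_{D,x_n}` and its fraction field). OURS row, OPEN; NOT a statement of the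
manuscript. [cite: CossartJannsenSaito2020, Thm. 3.14, Thm. 3.6, Prop. 6.31, Def. 6.34 (i)] -/
def StrataCentreMembersClean (p N : ℕ) (Q : ℕ → (ℕ → ℕ) → ∀ X : Scheme.{u}, X → Prop) (G : MarkedStage.{u} → Prop) : Prop :=
  ∀ (R : ∀ S : Scheme.{u}, CentreSeq S → Prop), OracleFunctional R → OracleAdmissible R →
  ∀ (ν : ℕ → ℕ) (X : Scheme.{u}) [IsLocallyNoetherian X] (x : X), IsMaximalOrigin p N ν X x → Q N ν X x →
  ∀ c : ℕ → MarkedStage.{u}, Reaches R N ν (MarkedStage.init X x) (c 0) →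
    (∀ n, CanonicalNearStep R N ν (c n) (c (n + 1))) → (∀ n, G (c n)) → (∀ n, ¬ Iso N (c n)) →
    (∀ n, ∃ m, n ≤ m ∧ (c m).IsBlownUp R N ν) →
    ∃ n₁, ∀ n, n₁ ≤ n → ∀ (C : (c n).W.IdealSheafData) (P' : Option (Pending (blowup C))),
      IsCanonicalStep R N ν (c n).L (c n).P C P' → (c n).pt ∈ (C.support : Set (c n).W) →
      ∀ f : (c (n + 1)).W ⟶ (c n).W, StepProjection R N ν (c n) (c (n + 1)) f →
        (∀ Z' ∈ componentsThrough N ν (c (n + 1)), ∀ Z'' ∈ componentsThrough N ν (c (n + 1)),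
            f.base '' Z' ⊆ (C.support : Set (c n).W) → f.base '' Z'' ⊆ (C.support : Set (c n).W) → Z' = Z'') ∧
        ∀ Z' ∈ componentsThrough N ν (c (n + 1)), f.base '' Z' ⊆ (C.support : Set (c n).W) →
          IsRegularCurveAt (c (n + 1)) Z'

/-- [OURS · L1 W4.2] **ROW (K-str) — STRICT TRANSFORMS OF REGULAR CURVES OFF THE CENTRE ARE CLEAN.** In the same scope: from some stage
on, for every irreducible component `Z` of `X_n(ν)` through `x_n` which is a regular curve at `x_n` and is NOT contained in the
canonical centre, the irreducible components of `X_{n+1}(ν)` through `x_{n+1}` dominating `Z` (image closure `= Z`) number at most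
one and are regular curves at `x_{n+1}`. Intended proof: off the centre the blow-down is an isomorphism, so a dominating component is
the strict transform `Z̃` of `Z`, birational onto `Z`; `𝒪_{Z,x_n}` is a DVR and `𝒪_{Z̃,x_{n+1}}` a local ring between it and its
fraction field, not a field — so equal to it. OURS row, OPEN; NOT a statement of the manuscript.
[cite: CossartJannsenSaito2020, Rem. 6.29 (1), Lemma 3.15 (1)] -/
def StrataStrictTransformClean (p N : ℕ) (Q : ℕ → (ℕ → ℕ) → ∀ X : Scheme.{u}, X → Prop) (G : MarkedStage.{u} → Prop) : Prop :=
  ∀ (R : ∀ S : Scheme.{u}, CentreSeq S → Prop), OracleFunctional R → OracleAdmissible R →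
  ∀ (ν : ℕ → ℕ) (X : Scheme.{u}) [IsLocallyNoetherian X] (x : X), IsMaximalOrigin p N ν X x → Q N ν X x →
  ∀ c : ℕ → MarkedStage.{u}, Reaches R N ν (MarkedStage.init X x) (c 0) →
    (∀ n, CanonicalNearStep R N ν (c n) (c (n + 1))) → (∀ n, G (c n)) → (∀ n, ¬ Iso N (c n)) →
    (∀ n, ∃ m, n ≤ m ∧ (c m).IsBlownUp R N ν) →
    ∃ n₁, ∀ n, n₁ ≤ n → ∀ (C : (c n).W.IdealSheafData) (P' : Option (Pending (blowup C))),
      IsCanonicalStep R N ν (c n).L (c n).P C P' →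
      ∀ f : (c (n + 1)).W ⟶ (c n).W, StepProjection R N ν (c n) (c (n + 1)) f →
        ∀ Z ∈ componentsThrough N ν (c n), ¬ Z ⊆ (C.support : Set (c n).W) → IsRegularCurveAt (c n) Z →
          (∀ Z' ∈ componentsThrough N ν (c (n + 1)), ∀ Z'' ∈ componentsThrough N ν (c (n + 1)),
              closure (f.base '' Z') = Z → closure (f.base '' Z'') = Z → Z' = Z'') ∧
          ∀ Z' ∈ componentsThrough N ν (c (n + 1)), closure (f.base '' Z') = Z → IsRegularCurveAt (c (n + 1)) Z'

/-! ## §3. From a clean treated label to a treated part regular at the chain point -/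

/-- **A clean treated label gives a treated part regular over the marked point**: if the label `j` is clean at `s` and the stratum is
closed with finitely many components (Noetherian stage), every point of the reduced part `(Y^{(j)})_red` over the marked point is a
regular point — near the marked point the part IS its unique member through it, and the stalk of a vanishing ideal depends only on
the germ of the closed set. [cite: StacksProject, Tag 01J7] -/
theorem LabelCleanAt.mem_regularLocus {s : MarkedStage.{u}} [IsNoetherian s.W] {j : ℕ} (hclean : LabelCleanAt N ν s j)
    (hY : IsClosed (Scheme.hsStratum s.W N ν)) (hcl : IsClosed (s.L.part (Scheme.hsStratum s.W N ν) j))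
    (y : ↥((treatedPartIdeal N ν s j hcl).subscheme))
    (hy : (treatedPartIdeal N ν s j hcl).subschemeι.base y = s.pt) :
    y ∈ Scheme.regularLocus (treatedPartIdeal N ν s j hcl).subscheme := by
  haveI := s.ln
  -- the member of the part through the marked point
  have hxpart : s.pt ∈ s.L.part (Scheme.hsStratum s.W N ν) j := by
    have : (treatedPartIdeal N ν s j hcl).subschemeι.base y ∈ ((treatedPartIdeal N ν s j hcl).support : Set s.W) :=
      (treatedPartIdeal N ν s j hcl).range_subschemeι ▸ Set.mem_range_self y
    rw [hy] at this
    simpa [treatedPartIdeal] using this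
  obtain ⟨Z, hZ, hlZ, hxZ⟩ := (s.L.mem_part_iff _ j _).mp hxpart
  have hZt : Z ∈ componentsThrough N ν s := ⟨hZ, hxZ⟩
  obtain ⟨-, hreg, -⟩ := hclean.2 Z hZt hlZ
  have hZcl : IsClosed Z := componentsIn.isClosed hY hZ
  -- the other label-`j` components miss the marked point
  let 𝒜 : Set (Set s.W) := {W | W ∈ componentsIn (Scheme.hsStratum s.W N ν) ∧ s.L.label W = j ∧ W ≠ Z}
  have h𝒜fin : 𝒜.Finite := (componentsIn.finite _).subset fun _ hW => hW.1
  have h𝒜cl : IsClosed (⋃₀ 𝒜) := by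
    rw [Set.sUnion_eq_biUnion]
    exact h𝒜fin.isClosed_biUnion fun W hW => componentsIn.isClosed hY hW.1
  have hx𝒜 : s.pt ∉ ⋃₀ 𝒜 := by
    rintro ⟨W, ⟨hW, hlW, hWZ⟩, hxW⟩
    exact hWZ (hclean.1 W ⟨hW, hxW⟩ Z hZt hlW hlZ)
  -- on the complement of the others, the part is `Z`
  let U : s.W.Opens := ⟨(⋃₀ 𝒜)ᶜ, h𝒜cl.isOpen_compl⟩
  have hxU : s.pt ∈ U := hx𝒜
  have hgerm : (s.L.part (Scheme.hsStratum s.W N ν) j) ∩ (U : Set s.W) = Z ∩ (U : Set s.W) := by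
    refine Set.Subset.antisymm ?_ (Set.inter_subset_inter_left _ (s.L.subset_part hZ hlZ))
    rintro q ⟨hq, hqU⟩
    obtain ⟨W, hW, hlW, hqW⟩ := (s.L.mem_part_iff _ j _).mp hq
    by_cases hWZ : W = Z
    · exact ⟨hWZ ▸ hqW, hqU⟩
    · exact absurd (Set.mem_sUnion.mpr ⟨W, ⟨hW, hlW, hWZ⟩, hqW⟩ : q ∈ ⋃₀ 𝒜) hqU
  have hstalk := stalkIdeal_vanishingIdeal_congr (Z := ⟨s.L.part (Scheme.hsStratum s.W N ν) j, hcl⟩) (Z' := ⟨Z, hZcl⟩)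
    U hxU hgerm
  -- regularity of the subscheme's local ring at `y`
  rw [Scheme.mem_regularLocus, isRegularLocalRing_stalk_subscheme_iff, hy]
  change IsRegularLocalRing (s.W.presheaf.stalk s.pt ⧸
    stalkIdeal (Scheme.IdealSheafData.vanishingIdeal ⟨s.L.part (Scheme.hsStratum s.W N ν) j, hcl⟩) s.pt)
  rw [hstalk]
  exact hreg hZcl


/-- A label absent at the marked stage is (vacuously) clean. [folklore] -/
theorem labelCleanAt_of_forall_ne {s : MarkedStage.{u}} {j : ℕ} (h : ∀ Z ∈ componentsThrough N ν s, s.L.label Z ≠ j) :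
    LabelCleanAt N ν s j :=
  ⟨fun Z hZ _ _ hl _ => absurd hl (h Z hZ), fun Z hZ hl => absurd hl (h Z hZ)⟩

/-- Labels newer than the year are absent, hence clean. [cite: CossartJannsenSaito2020, Rem. 6.29 (1)] -/
theorem labelCleanAt_of_year_lt {s : MarkedStage.{u}} (hlab : LabelInv N ν s) {j : ℕ} (hj : s.L.year < j) :
    LabelCleanAt N ν s j :=
  labelCleanAt_of_forall_ne fun Z _ hl => by have := hlab.label_le_year Z; omega

/-! ## §4. The label calculus of one step: parents; persist, birth, reset -/

namespace StepProjection

variable {s s' : MarkedStage.{u}} {f : s'.W ⟶ s.W}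

/-- **An OLD label is inherited from a parent through the previous chain point**: a component of `X_{n+1}(ν)` through `x_{n+1}` whose
label is `≤` the year of `X_n` dominates a component of `X_n(ν)` through `x_n` with the same label, and maps into it.
[cite: CossartJannsenSaito2020, Rem. 6.29 (1)] -/
theorem exists_parent (hf : StepProjection R N ν s s' f) {Z' : Set s'.W} (hZ' : Z' ∈ componentsThrough N ν s') {j : ℕ}
    (hl : s'.L.label Z' = j) (hj : j ≤ s.L.year) :
    closure (f.base '' Z') ∈ componentsThrough N ν s ∧ s.L.label (closure (f.base '' Z')) = j ∧
      f.base '' Z' ⊆ closure (f.base '' Z') := by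
  have hne : s'.L.label Z' ≠ s.L.year + 1 := by omega
  have hmem := hf.mem_componentsIn_of_label_ne hne
  exact ⟨closure_image_mem_componentsThrough hf hZ' hmem, (hf.label_eq_of_mem hmem) ▸ hl, subset_closure⟩

end StepProjection

section OneStep

variable {k : Type u} [Field k] {s s' : MarkedStage.{u}} {f : s'.W ⟶ s.W} {C : s.W.IdealSheafData}
  {P' : Option (Pending (blowup C))}

/-- **(persist) A clean old label stays clean**, given the two kernels AT THIS STEP: the members through `x_{n+1}` dominate THE clean
member `Z ∋ x_n`; inside the centre they are members over the centre (K-ctr), off the centre dominants of a regular curve (K-str).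
[cite: CossartJannsenSaito2020, Rem. 6.29 (1)] -/
theorem LabelCleanAt.persist (hf : StepProjection R N ν s s' f)
    (hctr : s.pt ∈ (C.support : Set s.W) →
      (∀ Z' ∈ componentsThrough N ν s', ∀ Z'' ∈ componentsThrough N ν s',
          f.base '' Z' ⊆ (C.support : Set s.W) → f.base '' Z'' ⊆ (C.support : Set s.W) → Z' = Z'') ∧
      ∀ Z' ∈ componentsThrough N ν s', f.base '' Z' ⊆ (C.support : Set s.W) → IsRegularCurveAt s' Z')
    (hstr : ∀ Z ∈ componentsThrough N ν s, ¬ Z ⊆ (C.support : Set s.W) → IsRegularCurveAt s Z →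
      (∀ Z' ∈ componentsThrough N ν s', ∀ Z'' ∈ componentsThrough N ν s',
          closure (f.base '' Z') = Z → closure (f.base '' Z'') = Z → Z' = Z'') ∧
      ∀ Z' ∈ componentsThrough N ν s', closure (f.base '' Z') = Z → IsRegularCurveAt s' Z')
    {j : ℕ} (hj : j ≤ s.L.year) (hclean : LabelCleanAt N ν s j) : LabelCleanAt N ν s' j := by
  -- the parent of any label-`j` member through `x_{n+1}` is THE clean member through `x_n`
  have hpar : ∀ Z' ∈ componentsThrough N ν s', s'.L.label Z' = j →
      closure (f.base '' Z') ∈ componentsThrough N ν s ∧ s.L.label (closure (f.base '' Z')) = j ∧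
        f.base '' Z' ⊆ closure (f.base '' Z') := fun Z' hZ' hl => hf.exists_parent hZ' hl hj
  refine ⟨fun Z' hZ' Z'' hZ'' hl' hl'' => ?_, fun Z' hZ' hl' => ?_⟩
  · obtain ⟨hP', hlP', hsub'⟩ := hpar Z' hZ' hl'
    obtain ⟨hP'', hlP'', hsub''⟩ := hpar Z'' hZ'' hl''
    have heq : closure (f.base '' Z'') = closure (f.base '' Z') := hclean.1 _ hP'' _ hP' hlP'' hlP'
    by_cases hZC : closure (f.base '' Z') ⊆ (C.support : Set s.W)
    · have hxC : s.pt ∈ (C.support : Set s.W) := hZC hP'.2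
      exact (hctr hxC).1 Z' hZ' Z'' hZ'' (hsub'.trans hZC) (hsub''.trans (heq ▸ hZC))
    · exact (hstr _ hP' hZC (hclean.2 _ hP' hlP')).1 Z' hZ' Z'' hZ'' rfl heq
  · obtain ⟨hP', hlP', hsub'⟩ := hpar Z' hZ' hl'
    by_cases hZC : closure (f.base '' Z') ⊆ (C.support : Set s.W)
    · have hxC : s.pt ∈ (C.support : Set s.W) := hZC hP'.2
      exact (hctr hxC).2 Z' hZ' (hsub'.trans hZC)
    · exact (hstr _ hP' hZC (hclean.2 _ hP' hlP')).2 Z' hZ' rfl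

/-- **(birth) The new label is clean**, given kernel (K-ctr) AT THIS STEP: newborn components lie over the centre (p505314), so a
newborn component through `x_{n+1}` forces `x_n` into the centre and is a member over the centre.
[cite: CossartJannsenSaito2020, Rem. 6.29 (1)] -/
theorem labelCleanAt_birth (hRf : OracleFunctional R) (hRa : OracleAdmissible R) (hν : ν ≠ iterPSum N Phi)
    (hinv : CycleInv k R N ν s) (hlab : LabelInv N ν s) (hf : StepProjection R N ν s s' f)
    (hcs : IsCanonicalStep R N ν s.L s.P C P')
    (hctr : s.pt ∈ (C.support : Set s.W) →
      (∀ Z' ∈ componentsThrough N ν s', ∀ Z'' ∈ componentsThrough N ν s',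
          f.base '' Z' ⊆ (C.support : Set s.W) → f.base '' Z'' ⊆ (C.support : Set s.W) → Z' = Z'') ∧
      ∀ Z' ∈ componentsThrough N ν s', f.base '' Z' ⊆ (C.support : Set s.W) → IsRegularCurveAt s' Z') :
    LabelCleanAt N ν s' (s.L.year + 1) := by
  -- a component with the new label is newborn, hence lies over the centre
  have hover : ∀ Z' ∈ componentsThrough N ν s', s'.L.label Z' = s.L.year + 1 →
      f.base '' Z' ⊆ (C.support : Set s.W) := by
    intro Z' hZ' hl
    have hnot : closure (f.base '' Z') ∉ componentsIn (Scheme.hsStratum s.W N ν) := by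
      intro hmem
      have h1 := hf.label_eq_of_mem hmem
      have h2 := hlab.label_le_year (closure (f.base '' Z'))
      omega
    obtain ⟨C₁, P₁, hcs₁, hsub⟩ := hf.subset_preimage_support_of_not_mem hRa hν hinv hZ'.1 hnot
    obtain rfl : C₁ = C := hcs₁.centre_unique hRf hcs
    rintro _ ⟨z, hz, rfl⟩
    exact hsub hz
  have hxC : ∀ Z' ∈ componentsThrough N ν s', s'.L.label Z' = s.L.year + 1 → s.pt ∈ (C.support : Set s.W) := by
    intro Z' hZ' hl
    have := hover Z' hZ' hl ⟨s'.pt, hZ'.2, rfl⟩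
    rwa [hf.base_pt] at this
  refine ⟨fun Z' hZ' Z'' hZ'' hl' hl'' => ?_, fun Z' hZ' hl' => ?_⟩
  · exact (hctr (hxC Z' hZ' hl')).1 Z' hZ' Z'' hZ'' (hover Z' hZ' hl') (hover Z'' hZ'' hl'')
  · exact (hctr (hxC Z' hZ' hl')).2 Z' hZ' (hover Z' hZ' hl')

/-- **(reset) After a cycle-END step the treated label is clean**, given kernel (K-ctr) AT THIS STEP: the centre is the whole treated
part `Y_n^{(j)}` (p503069), so the label-`j` members through `x_{n+1}` dominate members inside the centre.
[cite: CossartJannsenSaito2020, Rem. 6.29 (1)] -/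
theorem labelCleanAt_reset (hRf : OracleFunctional R) (hlab : LabelInv N ν s) (hf : StepProjection R N ν s s' f)
    (hnone : s'.P = none) (hcs : IsCanonicalStep R N ν s.L s.P C P') (hne : (Scheme.hsStratum s.W N ν).Nonempty)
    (hctr : s.pt ∈ (C.support : Set s.W) →
      (∀ Z' ∈ componentsThrough N ν s', ∀ Z'' ∈ componentsThrough N ν s',
          f.base '' Z' ⊆ (C.support : Set s.W) → f.base '' Z'' ⊆ (C.support : Set s.W) → Z' = Z'') ∧
      ∀ Z' ∈ componentsThrough N ν s', f.base '' Z' ⊆ (C.support : Set s.W) → IsRegularCurveAt s' Z') :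
    LabelCleanAt N ν s' (treatedLabel N ν s) := by
  have hsupp : (C.support : Set s.W) = s.L.part (Scheme.hsStratum s.W N ν) (treatedLabel N ν s) :=
    support_eq_part_of_next_none hRf hf.canonicalNearStep hnone hcs
  have hjy : treatedLabel N ν s ≤ s.L.year := treatedLabel_le_year hlab hne
  -- label-`j` members through `x_{n+1}` map into the centre, which then contains `x_n`
  have hover : ∀ Z' ∈ componentsThrough N ν s', s'.L.label Z' = treatedLabel N ν s →
      f.base '' Z' ⊆ (C.support : Set s.W) ∧ s.pt ∈ (C.support : Set s.W) := by
    intro Z' hZ' hl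
    obtain ⟨hP, hlP, hsub⟩ := hf.exists_parent hZ' hl hjy
    have hPC : closure (f.base '' Z') ⊆ (C.support : Set s.W) := hsupp ▸ s.L.subset_part hP.1 hlP
    exact ⟨hsub.trans hPC, hPC hP.2⟩
  refine ⟨fun Z' hZ' Z'' hZ'' hl' hl'' => ?_, fun Z' hZ' hl' => ?_⟩
  · exact (hctr (hover Z' hZ' hl').2).1 Z' hZ' Z'' hZ'' (hover Z' hZ' hl').1 (hover Z'' hZ'' hl'').1
  · exact (hctr (hover Z' hZ' hl').2).2 Z' hZ' (hover Z' hZ' hl').1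

end OneStep

end Summit.ResolutionOfSingularities.ResolutionOfSingularities.Theorems.SigmaMaxModificationsCorridor3.Moving

end
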